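import Summits.QuantumFields.YangMills.Theorems.BalabanUVNodesN21ChartExponentConvexityLocal

/-!
# N21 (NE7c) · THE (1.9) BINDER `h19` OF THE (M1) ENDs READ FROM PRINT's (1.7) ROW + THE TREE's PROVED (1.8)
# (tree ∕ axial gauge, cubic block) — and why the gauge fixing is load-bearing (file 6 of WIDTH-209 N21 piece 2)

Width seat pub-ymgap-dag-n21-w3 (g4), node N21 = NE7c (single-run shell-weight bound, NOT PRINTED in [Bałaban 1983–89],
NOT proved), lane K3⁷ `SpineGivenEndpointR13SepCoPH` (stmt-QuantumFields-20544, `--kind proof --supports … --as helper`).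

WHY.  Every (M1) END on the block chart (dag-n21-w1's p590709 ∕ p592783 ∕ p604008 ∕ p608182 ∕ p609856, dag-n21-w4's
p605099 ∕ p610497, dag-n21-w5's U(1) files, this seat's p606637 ∕ p607734 ∕ p611900 ∕ p613088) displays the coercivity of
the leading quadratic member as the row (1.9) ASKED OF THE FORM: `h19 : ∀ v, Ineq19 (Qf v) (Σ_b v_b²) γ₀ d M`.  Print
([LF-II] = CMP 122 p. 358) does not posit (1.9); it DERIVES it: *"The inequalities (1.7), (1.8) imply finally (1.9) for
g_k sufficiently small"*, where (1.7) is the positivity of Bałaban's operator `Δ₁(ζ₀)` against `‖∂B′‖²` up to an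
`O(1)(M⁶R_kε_k + e^{−R_k})‖B′‖²` correction, and (1.8) is the Poincaré-type inequality
`Σ_{b∈Λ}|B′(b)|² ≤ d(100M)^{d+1}Σ_{p∈Λ}|(∂B′)(p)|²` for *"fields B′ defined on Λ, and equal to 0 on bonds of the graph
G₀ … G₀ determines the axial gauge in Λ"*.  The Literature holds (1.8) PROVED for a cubic `Λ` in the comb (axial) tree
gauge (`B16Sect1Wilson.ineq18_cube` ∕ `ineq18_cube_vec`, via [Balaban1984PropagatorsII] (2.123)) and the implication
(1.7) ∧ (1.8) ⇒ (1.9) PROVED (`B16Sect1Wilson.ineq19_of_17_18`); before this file no module under `Summits/` imported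
`ineq18_cube_vec` or `ineq19_of_17_18` (`rg -l` over `lean/Summits`, 2026-08-28T08:00Z).  [v1.1: the Literature ALSO holds
(1.8) PROVED for RECTANGULAR PARALLELEPIPEDS — print's own shape of `Λ` — as `B16Eq18Proof.ineq18_box_vec` (2026-08-21);
the box editions of this file and of file 7 are files 8–9 `…N21ChartExponentCoercivityBox` ∕ `…CoercivityBoxSUN`
(dag-n21-w3 g5), which also drop the side binder `1 ≤ n`, and file 10 `…N21ChartExponentCoercivityAxialComb` supplies the
bond dictionary at pub-balaban's axial comb of a non-wrapping torus box (`T4AxialGaugeFixing.combBonds`).]  This file reads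
the ENDs' `h19` from the (1.7) row + those two theorems on the OFF-TREE block chart,
and certifies that the tree condition is load-bearing: on the un-gauge-fixed bond chart a pure gauge `B′ = dλ` has
`∂B′ = 0 ≠ B′`, so no (1.8) — hence no (1.9) from (1.7) — can hold there (the exponent-side twin of dag-n21-w2 g2's
LOCATED-1 INBOX l.30536: the measure side's window letter `hlaw` is vacuous without a tree gauge).

WHAT (THEOREMS ONLY; 0 `def`, 0 `sorry`).  Carrier: `B6TreeGaugePoincare` (sites `Fin d → ℤ`, bonds `(z, μ) = ⟨z, z+e_μ⟩`,
`curl`, the cube `block n y`, its `innerBonds` ∕ `innerPlaq`, the comb tree `treeBonds n y`); 𝔤-coordinates `Fin D`.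
* §1 [folklore] the OFF-TREE CHART FRAME `κ = ↥(innerBonds n y ∖ treeBonds n y) × Fin D` and its extension by zero to
  bond configurations: `extendOffTree_tree` (zero on the tree), `sum_sq_extendOffTree` (`Σ_{b⊂Λ}Σ_a ext(v)_a(b)² = Σ_κ v²`).
* §2 ★ `ineq19_of_ineq17_treeGauge` (abstract: ANY frame `κ` with ANY extension `E` vanishing on the tree and preserving
  the sum of squares) and ★ `ineq19_offTree_of_ineq17` (the frame of §1): from the (1.7) row
  `∀ v, Ineq17 (Qf v) (Σ_{p⊂Λ}Σ_a (∂ ext(v)_a)(p)²) (Σ_κ v²) γ₀ C M R_k ε_k`, `1 ≤ d`, `1 ≤ n ≤ 100M`, `0 ≤ γ₀` and the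
  smallness `C(M⁶R_kε_k + e^{−R_k}) ≤ γ₀∕(2d(100M)^{d+1})` ⇒ `∀ v, Ineq19 (Qf v) (Σ_κ v²) γ₀ d M` — the ENDs' `h19`
  VERBATIM (flat frame).
* §3 ★★ `convexOn_treeGaugeChart_expansion_of_ineq17_analyticSupBound`: file 4's (p611900) ★★′-loc with `h19`
  DISCHARGED by §2 — convexity of the (1.2)-shaped exponent from the (1.7) row + the smallness line + the analyticity
  letter + the clause, on any tree-gauge-fixed chart frame.
* §4 [textbook] A2 `curl_grad_eq_zero` (a gradient 1-form is closed) and `ineq18_void_without_tree`: for `2 ≤ n` the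
  gradient of the corner's indicator has `Σ_{p⊂Λ}(∂B′)(p)² = 0 < Σ_{b⊂Λ}B′(b)²`, so `Ineq18`'s conclusion FAILS for it at
  every `M` — without `B′ = 0` on `G₀` there is no (1.8), and (1.7) alone gives no (1.9).
* §5 A6 `ineq17_binders_inhabited`: §2's binder list is jointly inhabited by a non-zero form (`Qf = γ₀·Σ(∂·)²`, `C = 0`,
  `γ₀ = 1`), on which §2 returns the rescaled (1.8).

HONEST FRAMING.  [textbook]∕[folklore] over two Literature theorems BY NAME (8 theorems in this file).  (1.8) is used
here for cubic `Λ` only; v1.1 CORRECTION: the sentence «rectangular parallelepipeds are the Literature's TODO» of v1 repeated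
the stale TODO line of `B16Sect1Wilson.ineq18_cube` and was WRONG — `B16Eq18Proof.ineq18_box_vec` proves (1.8) for
rectangular parallelepipeds, and files 8–9 are this file ∕ file 7 on that carrier (lane referee READ-248, INBOX l.36622,
NITs (i)–(iii)); (1.7) — positivity of `Δ₁(ζ₀)` with its correction — is a
DISPLAYED ROW about NODE O's operator, NOT asserted; the identification of an END's `Qf` with «the leading quadratic form
⟨H_{1,k}B′, Δ₁(ζ₀)H_{1,k}B′⟩» and of `κ` with the block's off-tree bond variables is LOCATED typing; the dictionary
between pub-balaban's torus bonds `PBond P j` (`BlockChartSU N b`) and the `ℤ^d` cube carrier is NOT typed here; nothing of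
Bałaban's asserted; (M1) ∕ NE7c NOT PRINTED ∕ NOT proved; N21 NOT discharged; K3⁷ NOT claimed; counts unmoved (typed 28∕28 ·
discharged 5∕27); count-neutral; one finite 𝕋⁴ at fixed ε — the Yang–Mills mass gap (Clay) is NOT proved by any of this:
R4 closes the conditional finite-𝕋⁴ rung `BalabanLadder.UV` only; nothing continuum ∕ ℝ⁴ ∕ OS.
-/

set_option autoImplicit false

noncomputable section

open Set Function Finset Matrix Metric

namespace Summit.QuantumFields.YangMills.Theorems.N21ChartExponentCoercivity

open Literature.MathematicalPhysics.QuantumFieldTheory.Balaban1983to89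
open Literature.MathematicalPhysics.QuantumFieldTheory.Balaban1983to89.B16Sect1Wilson
  (Ineq17 Ineq18 Ineq19 ineq19_of_17_18 ineq18_cube_vec)
open Literature.MathematicalPhysics.QuantumFieldTheory.Balaban1983to89.B6TreeGaugePoincare
  (Cfg curl innerBonds innerPlaq mem_innerBonds treeBonds_subset_innerBonds)
open Literature.MathematicalPhysics.QuantumFieldTheory.Balaban1983to89.B6BondElimination (treeBonds unitVec unitVec_apply)
open Literature.MathematicalPhysics.QuantumFieldTheory.Balaban1983to89.B6Elimination (block mem_block)
open Summit.QuantumFields.YangMills.Theorems.N21ChartExponentConvexityLocal (convexOn_expansion_of_analyticSupBound_local)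

variable {d : ℕ}

/-! ## §1  The off-tree chart frame and its extension by zero -/

section Frame

variable {n D : ℕ} {y : Fin d → ℤ}

/-- the extension by zero of off-tree chart coordinates VANISHES ON THE TREE `G₀` (the hypothesis of (1.8)). [folklore] -/
theorem extendOffTree_tree (v : ↥(innerBonds n y \ treeBonds n y) × Fin D → ℝ) :
    ∀ b ∈ treeBonds n y,
      (fun a : Fin D => if h : b ∈ innerBonds n y \ treeBonds n y then v (⟨b, h⟩, a) else (0 : ℝ)) = 0 := by
  intro b hb
  funext a
  have : b ∉ innerBonds n y \ treeBonds n y := fun h => (mem_sdiff.1 h).2 hb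
  simp only [dif_neg this, Pi.zero_apply]

/-- the extension by zero PRESERVES THE SUM OF SQUARES over the block's bonds: `Σ_{b⊂Λ} Σ_a ext(v)_a(b)² = Σ_κ v²`
(the tree bonds contribute `0`, the off-tree bonds are the chart coordinates). [folklore] -/
theorem sum_sq_extendOffTree (v : ↥(innerBonds n y \ treeBonds n y) × Fin D → ℝ) :
    ∑ b ∈ innerBonds n y, ∑ a : Fin D,
        (if h : b ∈ innerBonds n y \ treeBonds n y then v (⟨b, h⟩, a) else (0 : ℝ)) ^ 2 = ∑ i, v i ^ 2 := by
  rw [← sum_sdiff (treeBonds_subset_innerBonds (L := n) y)]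
  have htree : ∑ b ∈ treeBonds n y, ∑ a : Fin D,
      (if h : b ∈ innerBonds n y \ treeBonds n y then v (⟨b, h⟩, a) else (0 : ℝ)) ^ 2 = 0 := by
    refine sum_eq_zero fun b hb => sum_eq_zero fun a _ => ?_
    have : b ∉ innerBonds n y \ treeBonds n y := fun h => (mem_sdiff.1 h).2 hb
    simp only [dif_neg this]
    ring
  rw [htree, add_zero, ← sum_coe_sort (innerBonds n y \ treeBonds n y), Fintype.sum_prod_type]
  refine sum_congr rfl fun b _ => sum_congr rfl fun a _ => ?_
  simp only [dif_pos b.2]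

end Frame

/-! ## §2  ★ The (1.9) binder from the (1.7) row + PROVED (1.8) + the smallness line -/

section Coercivity

/-- ★ **(1.9) FROM (1.7) + PROVED (1.8), ABSTRACT TREE-GAUGE FRAME.**  Let `κ` index real chart coordinates and `E`
extend a coordinate vector to a 𝔤-valued bond configuration on the cube `Λ = block n y` (`1 ≤ n ≤ 100M`) VANISHING ON
THE TREE `G₀ = treeBonds n y` and PRESERVING the sum of squares.  If the quadratic member `Qf` obeys print's (1.7) row
for every `v` — `γ₀·Σ_{p⊂Λ}|(∂E v)(p)|² − C(M⁶R_kε_k + e^{−R_k})·Σ_κ v² ≤ Qf v` — and the smallness line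
`C(M⁶R_kε_k + e^{−R_k}) ≤ γ₀∕(2d(100M)^{d+1})` holds («for g_k sufficiently small»), then the ENDs' binder
`∀ v, Ineq19 (Qf v) (Σ_κ v²) γ₀ d M` holds: (1.8) is the tree theorem `B16Sect1Wilson.ineq18_cube_vec`, the
implication is `B16Sect1Wilson.ineq19_of_17_18`. [cite: Balaban1989LargeFieldII, (1.7)–(1.9) p.358] [folklore] -/
theorem ineq19_of_ineq17_treeGauge {κ : Type*} [Fintype κ] {n D : ℕ} (M : ℕ) (hd : 1 ≤ d) (hn : 1 ≤ n)
    (hnM : n ≤ 100 * M) (hM : 0 < M) (y : Fin d → ℤ)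
    (E : (κ → ℝ) → ((Fin d → ℤ) × Fin d → (Fin D → ℝ)))
    (hEtree : ∀ v, ∀ b ∈ treeBonds n y, E v b = 0)
    (hEsq : ∀ v, ∑ b ∈ innerBonds n y, ∑ a, E v b a ^ 2 = ∑ i, v i ^ 2)
    (Qf : (κ → ℝ) → ℝ) {γ₀ C Rk εk : ℝ} (hγ : 0 ≤ γ₀)
    (h17 : ∀ v, Ineq17 (Qf v) (∑ p ∈ innerPlaq n y, ∑ a, curl (fun b => E v b a) p.1 p.2.1 p.2.2 ^ 2)
      (∑ i, v i ^ 2) γ₀ C M Rk εk)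
    (hsmall : C * ((M : ℝ) ^ 6 * Rk * εk + Real.exp (-Rk)) ≤ γ₀ / (2 * d * (100 * (M : ℝ)) ^ (d + 1))) :
    ∀ v, Ineq19 (Qf v) (∑ i, v i ^ 2) γ₀ d M := by
  intro v
  have hM' : (0 : ℝ) < (M : ℝ) := by exact_mod_cast hM
  have hnB : (0 : ℝ) ≤ ∑ i, v i ^ 2 := Finset.sum_nonneg fun i _ => sq_nonneg (v i)
  have h18 : Ineq18 (∑ i, v i ^ 2) (∑ p ∈ innerPlaq n y, ∑ a, curl (fun b => E v b a) p.1 p.2.1 p.2.2 ^ 2) d M := by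
    unfold Ineq18
    rw [← hEsq v]
    exact ineq18_cube_vec M hn hnM y (E v) (hEtree v)
  exact ineq19_of_17_18 hd hM' hγ hnB (h17 v) h18 hsmall

/-- ★ **(1.9) FROM (1.7) + PROVED (1.8) ON THE OFF-TREE BLOCK CHART** `κ = ↥(innerBonds n y ∖ treeBonds n y) × Fin D`
(§1's extension by zero): the ENDs' `h19` read from the (1.7) row + the smallness line.
[cite: Balaban1989LargeFieldII, (1.7)–(1.9) p.358] [folklore] -/
theorem ineq19_offTree_of_ineq17 {n D : ℕ} (M : ℕ) (hd : 1 ≤ d) (hn : 1 ≤ n) (hnM : n ≤ 100 * M) (hM : 0 < M)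
    (y : Fin d → ℤ) (Qf : (↥(innerBonds n y \ treeBonds n y) × Fin D → ℝ) → ℝ) {γ₀ C Rk εk : ℝ} (hγ : 0 ≤ γ₀)
    (h17 : ∀ v, Ineq17 (Qf v)
      (∑ p ∈ innerPlaq n y, ∑ a : Fin D,
        curl (fun b => if h : b ∈ innerBonds n y \ treeBonds n y then v (⟨b, h⟩, a) else (0 : ℝ)) p.1 p.2.1 p.2.2 ^ 2)
      (∑ i, v i ^ 2) γ₀ C M Rk εk)
    (hsmall : C * ((M : ℝ) ^ 6 * Rk * εk + Real.exp (-Rk)) ≤ γ₀ / (2 * d * (100 * (M : ℝ)) ^ (d + 1))) :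
    ∀ v, Ineq19 (Qf v) (∑ i, v i ^ 2) γ₀ d M := by
  intro v
  have hM' : (0 : ℝ) < (M : ℝ) := by exact_mod_cast hM
  have hnB : (0 : ℝ) ≤ ∑ i, v i ^ 2 := Finset.sum_nonneg fun i _ => sq_nonneg (v i)
  -- (1.8) for the extension by zero of `v` (zero on the tree), read back on the chart coordinates by §1
  have h18raw := ineq18_cube_vec (D := D) M hn hnM y
    (fun (b : (Fin d → ℤ) × Fin d) (a : Fin D) => if h : b ∈ innerBonds n y \ treeBonds n y then v (⟨b, h⟩, a) else (0 : ℝ))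
    (extendOffTree_tree v)
  rw [sum_sq_extendOffTree v] at h18raw
  exact ineq19_of_17_18 hd hM' hγ hnB (h17 v) h18raw hsmall

end Coercivity

/-! ## §3  ★★ Convexity of the (1.2)-shaped exponent on a tree-gauge-fixed chart from the (1.7) row -/

section Convexity

/-- ★★ **CONVEXITY OF THE (1.2)-SHAPED EXPONENT FROM THE (1.7) ROW** (file 4's ★★′-loc with `h19` DISCHARGED by §2):
on a convex cut `K` of ANY tree-gauge-fixed chart frame `κ` (extension `E` zero on `G₀`, sum of squares preserved),
`φ = c + ½·Qf + lin + Vt` with `Qf v = v ⬝ᵥ (A *ᵥ v)` obeying the (1.7) row for every `v`, `lin = ⇑ℓ`, `Vt = Re Φ∘ι`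
with `Φ` ℂ-differentiable and `‖Φ‖ ≤ S` on the `r`-ball about every real point of `K` (`0 < r`), the smallness line and
the clause `4·d·(100M)^{d+1}·S ≤ γ₀·r²` ⇒ `ConvexOn ℝ K φ`. [cite: Balaban1989LargeFieldII, (1.7)–(1.9) p.358] [textbook] -/
theorem convexOn_treeGaugeChart_expansion_of_ineq17_analyticSupBound {κ : Type*} [Fintype κ] {n D : ℕ} (M : ℕ)
    (hd : 1 ≤ d) (hn : 1 ≤ n) (hnM : n ≤ 100 * M) (hM : 0 < M) (y : Fin d → ℤ)
    (E : (κ → ℝ) → ((Fin d → ℤ) × Fin d → (Fin D → ℝ)))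
    (hEtree : ∀ v, ∀ b ∈ treeBonds n y, E v b = 0)
    (hEsq : ∀ v, ∑ b ∈ innerBonds n y, ∑ a, E v b a ^ 2 = ∑ i, v i ^ 2)
    {K : Set (κ → ℝ)} (hK : Convex ℝ K)
    (φ Qf lin Vt : (κ → ℝ) → ℝ) (c : ℝ) (hexp : ∀ v ∈ K, φ v = c + 1 / 2 * Qf v + lin v + Vt v)
    (A : Matrix κ κ ℝ) (hQf : ∀ v, Qf v = v ⬝ᵥ (A *ᵥ v))
    {γ₀ C Rk εk : ℝ} (hγ : 0 ≤ γ₀)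
    (h17 : ∀ v, Ineq17 (Qf v) (∑ p ∈ innerPlaq n y, ∑ a, curl (fun b => E v b a) p.1 p.2.1 p.2.2 ^ 2)
      (∑ i, v i ^ 2) γ₀ C M Rk εk)
    (hsmall : C * ((M : ℝ) ^ 6 * Rk * εk + Real.exp (-Rk)) ≤ γ₀ / (2 * d * (100 * (M : ℝ)) ^ (d + 1)))
    (ℓ : (κ → ℝ) →ₗ[ℝ] ℝ) (hlin : ∀ v, lin v = ℓ v)
    (Φ : (κ → ℂ) → ℂ) {r S : ℝ} (hr : 0 < r) (hVt : ∀ x ∈ K, Vt x = (Φ fun i => (x i : ℂ)).re)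
    (hΦd : ∀ x ∈ K, DifferentiableOn ℂ Φ (ball (fun i => (x i : ℂ)) r))
    (hΦS : ∀ x ∈ K, ∀ u ∈ ball (fun i => (x i : ℂ)) r, ‖Φ u‖ ≤ S)
    (hclause : 4 * d * (100 * (M : ℝ)) ^ (d + 1) * S ≤ γ₀ * r ^ 2) :
    ConvexOn ℝ K φ :=
  convexOn_expansion_of_analyticSupBound_local hK φ Qf lin Vt c hexp A hQf hd (by exact_mod_cast hM)
    (ineq19_of_ineq17_treeGauge M hd hn hnM hM y E hEtree hEsq Qf hγ h17 hsmall) ℓ hlin Φ hr hVt hΦd hΦS hclause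

end Convexity

/-! ## §4  A2: without the tree condition there is no (1.8) — a pure gauge is `∂`-closed and non-zero -/

section Gauge

/-- **A GRADIENT 1-FORM IS CLOSED**: for `B′⟨z, z+e_μ⟩ = λ(z+e_μ) − λ(z)` every plaquette circulation vanishes,
`(∂B′)(p) = 0` (a pure gauge has no field strength). [textbook] -/
theorem curl_grad_eq_zero (lam : (Fin d → ℤ) → ℝ) (z : Fin d → ℤ) (j μ : Fin d) :
    curl (fun b : (Fin d → ℤ) × Fin d => lam (b.1 + unitVec b.2) - lam b.1) z j μ = 0 := by
  simp only [curl]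
  rw [add_right_comm z (unitVec j) (unitVec μ)]
  ring

/-- **A2: (1.8) IS VOID ON THE UN-GAUGE-FIXED BOND CHART.**  On a cube `Λ = block n y` of side `n ≥ 2` (so that the bond
`⟨y, y+e_μ⟩` is inside), the gradient `B′ = dλ` of the corner's indicator `λ = 𝟙_{y}` has `Σ_{p⊂Λ}|(∂B′)(p)|² = 0` and
`Σ_{b⊂Λ}|B′(b)|² ≥ |B′⟨y, y+e_μ⟩|² = 1 > 0`; hence `Ineq18 (Σ|B′|²) (Σ|∂B′|²) d M` FAILS for it at every `M` — print's
proviso «B′ … equal to 0 on bonds of the graph G₀» is load-bearing, and on the full bond chart (1.7) yields no (1.9).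
[cite: Balaban1989LargeFieldII, (1.8) p.358] [textbook] -/
theorem ineq18_void_without_tree {n : ℕ} (hn : 2 ≤ n) (y : Fin d → ℤ) (μ : Fin d) (M : ℝ) :
    ∃ B : Cfg d,
      (∑ p ∈ innerPlaq n y, curl B p.1 p.2.1 p.2.2 ^ 2) = 0 ∧
      0 < ∑ b ∈ innerBonds n y, B b ^ 2 ∧
      ¬ Ineq18 (∑ b ∈ innerBonds n y, B b ^ 2) (∑ p ∈ innerPlaq n y, curl B p.1 p.2.1 p.2.2 ^ 2) d M := by
  classical
  -- the bond ⟨y, y + e_μ⟩ lies inside the cube `block n y` (side `n ≥ 2`), and `y + e_μ ≠ y`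
  have hy : y ∈ block n y := mem_block.2 fun i => ⟨le_rfl, by omega⟩
  have hb : (y, μ) ∈ innerBonds n y := mem_innerBonds.2 ⟨hy, by dsimp only; omega⟩
  have hne : y + unitVec μ ≠ y := by
    intro h
    have := congrArg (fun z => z μ) h
    simp [unitVec_apply] at this
  -- the corner's indicator `λ = 𝟙_{y}` and its gradient `B′ = dλ`
  obtain ⟨lam, hlam⟩ : ∃ lam : (Fin d → ℤ) → ℝ, lam = fun z => if z = y then 1 else 0 := ⟨_, rfl⟩
  have hcurl : (∑ p ∈ innerPlaq n y,
      curl (fun b : (Fin d → ℤ) × Fin d => lam (b.1 + unitVec b.2) - lam b.1) p.1 p.2.1 p.2.2 ^ 2) = 0 :=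
    sum_eq_zero fun p _ => by rw [curl_grad_eq_zero]; ring
  have hval : (lam ((y, μ).1 + unitVec (y, μ).2) - lam (y, μ).1) ^ 2 = 1 := by
    norm_num [hlam, hne]
  have hpos : (1 : ℝ) ≤ ∑ b ∈ innerBonds n y, (lam (b.1 + unitVec b.2) - lam b.1) ^ 2 := by
    rw [← hval]
    exact single_le_sum (f := fun b : (Fin d → ℤ) × Fin d => (lam (b.1 + unitVec b.2) - lam b.1) ^ 2)
      (fun b _ => sq_nonneg _) hb
  refine ⟨fun b => lam (b.1 + unitVec b.2) - lam b.1, hcurl, lt_of_lt_of_le zero_lt_one hpos, fun h18 => ?_⟩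
  -- `Ineq18` would read `Σ|B′|² ≤ d(100M)^{d+1}·0`
  unfold Ineq18 at h18
  rw [hcurl, mul_zero] at h18
  linarith

end Gauge

/-! ## §5  A6: §2's binder list is jointly inhabited by a non-zero form -/

section Witness

/-- **A6**: the hypotheses of ★ `ineq19_of_ineq17_treeGauge` are jointly inhabited NON-TRIVIALLY — take the quadratic
member `Qf v := Σ_{p⊂Λ}|(∂E v)(p)|²` itself (`γ₀ = 1`, `C = 0`: (1.7) with equality, the smallness line `0 ≤ …`); ★ then
returns the rescaled (1.8): `Σ_κ v² ∕ (2d(100M)^{d+1}) ≤ Σ_{p⊂Λ}|(∂E v)(p)|²`. [folklore] -/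
theorem ineq17_binders_inhabited {κ : Type*} [Fintype κ] {n D : ℕ} (M : ℕ) (hd : 1 ≤ d) (hn : 1 ≤ n)
    (hnM : n ≤ 100 * M) (hM : 0 < M) (y : Fin d → ℤ)
    (E : (κ → ℝ) → ((Fin d → ℤ) × Fin d → (Fin D → ℝ)))
    (hEtree : ∀ v, ∀ b ∈ treeBonds n y, E v b = 0)
    (hEsq : ∀ v, ∑ b ∈ innerBonds n y, ∑ a, E v b a ^ 2 = ∑ i, v i ^ 2) (Rk εk : ℝ) :
    (∀ v, Ineq17 (∑ p ∈ innerPlaq n y, ∑ a, curl (fun b => E v b a) p.1 p.2.1 p.2.2 ^ 2)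
      (∑ p ∈ innerPlaq n y, ∑ a, curl (fun b => E v b a) p.1 p.2.1 p.2.2 ^ 2) (∑ i, v i ^ 2) 1 0 M Rk εk) ∧
    (0 : ℝ) * ((M : ℝ) ^ 6 * Rk * εk + Real.exp (-Rk)) ≤ 1 / (2 * d * (100 * (M : ℝ)) ^ (d + 1)) ∧
    ∀ v, Ineq19 (∑ p ∈ innerPlaq n y, ∑ a, curl (fun b => E v b a) p.1 p.2.1 p.2.2 ^ 2) (∑ i, v i ^ 2) 1 d M := by
  have h17 : ∀ v, Ineq17 (∑ p ∈ innerPlaq n y, ∑ a, curl (fun b => E v b a) p.1 p.2.1 p.2.2 ^ 2)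
      (∑ p ∈ innerPlaq n y, ∑ a, curl (fun b => E v b a) p.1 p.2.1 p.2.2 ^ 2) (∑ i, v i ^ 2) 1 0 M Rk εk := by
    intro v
    unfold Ineq17
    simp
  have hsmall : (0 : ℝ) * ((M : ℝ) ^ 6 * Rk * εk + Real.exp (-Rk)) ≤ 1 / (2 * d * (100 * (M : ℝ)) ^ (d + 1)) := by
    rw [zero_mul]
    have hd0 : (0 : ℝ) < d := by exact_mod_cast hd
    have hM0 : (0 : ℝ) < M := by exact_mod_cast hM
    positivity
  exact ⟨h17, hsmall, ineq19_of_ineq17_treeGauge M hd hn hnM hM y E hEtree hEsq _ zero_le_one h17 hsmall⟩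

end Witness

end Summit.QuantumFields.YangMills.Theorems.N21ChartExponentCoercivity

end
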